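import Mathlib
import Literature.NumberTheory.LFunctions.Zhang2022.TypedSection16B
import HarnessLib

/-!
# Zhang (2022) §16 Lemma 16.2 at the repaired normaliser WITH AN EXPLICIT (`D`-dependent) BOUND —
# `Lemma162Rp` (ZHANG-L WP16, zl-libC-p2 advisory 2026-08-27T00:32:40Z; cell RULING 15e pattern)

Topic `Literature/NumberTheory/LFunctions/Zhang2022` (Landau–Siegel audit tree; verdict-neutral).
Y. Zhang, *Discrete mean estimates and the Landau–Siegel zero*, arXiv:2211.02515v1 (2022)
[Zhang2022LandauSiegel] — **an unrefereed manuscript under adjudication; the `def … : Prop` below is a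
READING of Lemma 16.2 (§16 p. 94), STATED NOT ASSERTED; nothing here asserts or denies Theorems 1–2.**

WHY (numbers; zl-libC-p2 → zl-w16-plan and zl-w16-typer, HOME/INBOX 2026-08-27T00:32:40Z). The repair candidate of
row G-d57-1, `Typed.Section16B.Lemma162R` (`E₂ⱼ` at the normaliser `ζ(s)²ζ(s−βⱼ)L(s,χ)L(s−βⱼ,χ)²`),
asserts boundedness as `∃ B, ∀ s, 9/10 < Re s → ‖U s‖ ≤ B` INSIDE `ForAllLarge` — `B = B(D,χ,j)`
unquantified. The contour shift behind `Step16_u041aR` («as in the proof of Lemma 8.4», §16 p. 94 tex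
L4662) bounds the left line by `sup‖ζ²ζL L²‖ · sup‖E₂ⱼ‖ · T^{−η}`, so with an unknown `B` no uniform
constant in `C·(1+|L′(1,χ)|)³𝓛⁻⁴` can come out: `Step16_u041aR` is NOT derivable from `Lemma162R`.
What suffices — and is what the Euler product gives (factors `(1−q^{−s})²(1−q^{−(s−βⱼ)})(1+O(q^{−σ}))` at
`q ∣ D`, so `∏_{q∣D}(1+cq^{−0.95})^k ≤ exp(c′𝓛^{1/10})`; `1 + O(q^{−2σ+0.1})` at `q ∤ D`) — is an
EXPLICIT bound `‖U(s)‖ ≤ C·exp(2𝓛^{1/10})` on `Re s ≥ 19/20` with an absolute `C`: then the left line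
at the fixed abscissa `a = −1/20` costs `exp(2𝓛^{1/10})·T^{−1/20} = exp(−𝓛^{1.1}/20 + O(𝓛^{0.1}))`,
negligible. This is exactly the §15 precedent (cell RULING 15e: `Typed.Section15C.Lemma153Rp`, the
`D`-dependent reading of "bounded" for Lemma 15.3). This file types the primed reading `Lemma162Rp`
(= `Lemma162R` ∧ the explicit bound on `Re s ≥ 19/20`, so `lemma162R_of_Rp` is trivial and every
consumer of `Lemma162R` — `step16_u039R_of_lemma162R`, `eq16_16R2_of_subleaves` — keeps working), plus
the bookkeeping `step16_u039R_of_lemma162Rp`, `step16_u041bR_of_lemma162Rp` and, for the prover of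
u041aR, `frakU2R_explicit_bound_of_lemma162Rp` (the chosen continuation `frakU2R` obeys the explicit
bound). WP-internal reading (R-20); binder use (h162 := `Lemma162Rp` in the sub-leaf assembly, or `Rp`
only as u041aR's input) is the planner's call. No instance, no notation; `𝔢`-free (no RT-05 twin).

## References

* Y. Zhang, arXiv:2211.02515v1 (2022), §16 Lemma 16.2 p. 94 (tex L4646–L4653), p. 94 u040–u041
  (tex L4655–L4665); App. A p. 105–106; §8 Lemma 8.4. [cite: Zhang2022LandauSiegel, §16 Lemma 16.2 p.94]
-/

noncomputable section

open Complex Real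
open Literature.NumberTheory.LFunctions.Zhang2022
open Literature.NumberTheory.LFunctions.Zhang2022.Skeleton
open Literature.NumberTheory.LFunctions.Zhang2022.Typed.Section16A

namespace Literature.NumberTheory.LFunctions.Zhang2022.Typed.Section16B

variable (c' : ℝ)

/-- **Lemma 16.2 for the repaired object, with an EXPLICIT `D`-dependent bound** (reading of the printed
"bounded for `σ > 9/10`"; G-d57-1 repair candidate × cell RULING 15e pattern): for all large `D` under
(A) and `j = 1, 2`, `E₂ⱼ` (= `frakU2SeriesR` on `σ > 1`) has an analytic continuation `U` to `σ > 9/10`,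
bounded there, with `‖U(s)‖ ≤ C·exp(2𝓛^{1/10})` for `Re s ≥ 19/20` (`C` absolute) and
`U(1) = (6/π²)(φ(D)/(D𝔭))∏_{q∣D} q/(q+1) + O(𝓛⁻⁴)`. NOT PRINTED (the printed Lemma 16.2 has the normaliser
`(ζ³L³)⁻¹`, G-d57-1, and the bare word "bounded"); implies `Lemma162R` (`lemma162R_of_Rp`). CLAIM.
[cite: Zhang2022LandauSiegel, §16 Lemma 16.2 p.94] -/
def Lemma162Rp : Prop :=
  ∃ C : ℝ, ForAllLarge fun D _ χ => AssumptionA D χ → ∀ j ∈ ({1, 2} : Finset ℕ),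
    ∃ U : ℂ → ℂ, DifferentiableOn ℂ U {s : ℂ | 9 / 10 < s.re} ∧
      (∀ s : ℂ, 1 < s.re → U s = frakU2SeriesR c' χ j s) ∧
      (∃ B : ℝ, ∀ s : ℂ, 9 / 10 < s.re → ‖U s‖ ≤ B) ∧
      (∀ s : ℂ, 19 / 20 ≤ s.re → ‖U s‖ ≤ C * Real.exp (2 * ell D ^ (1 / 10 : ℝ))) ∧
      ‖U 1 - frakU2Main χ‖ ≤ C * (ell D ^ 4)⁻¹

/-- `Lemma162Rp ⇒ Lemma162R` (drop the explicit bound). [cite: Zhang2022LandauSiegel, §16 Lemma 16.2 p.94] -/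
theorem lemma162R_of_Rp (h : Lemma162Rp c') : Lemma162R c' := by
  obtain ⟨C, D₀, hC⟩ := h
  refine ⟨C, D₀, fun D _ χ hD hq hp hA j hj => ?_⟩
  obtain ⟨U, hU, hUeq, hB, -, hval⟩ := hC D χ hD hq hp hA j hj
  exact ⟨U, hU, hUeq, hB, hval⟩

/-- `Lemma162Rp ⇒ Step16_u039R` (value at `1` of the chosen continuation).
[cite: Zhang2022LandauSiegel, §16 Lemma 16.2 p.94] -/
theorem step16_u039R_of_lemma162Rp (h : Lemma162Rp c') : Step16_u039R c' :=
  step16_u039R_of_lemma162R c' (lemma162R_of_Rp c' h)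

/-- `Lemma162Rp ⇒ Step16_u041bR` (the (2.31)-algebra, via u039R).
[cite: Zhang2022LandauSiegel, §16 p.94] -/
theorem step16_u041bR_of_lemma162Rp (h : Lemma162Rp c') : Step16_u041bR c' :=
  step16_u041bR_of_u039R c' (step16_u039R_of_lemma162Rp c' h)

/-- **The chosen continuation obeys the explicit bound**: under `Lemma162Rp`, for all large `D`, (A),
`j = 1, 2`: `frakU2R c′ χ j` (the `acVal`-continuation entering `integrand16_u040R`) is differentiable on
`σ > 9/10`, equals `frakU2SeriesR` on `σ > 1`, and satisfies `‖frakU2R c′ χ j s‖ ≤ C·exp(2𝓛^{1/10})`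
for `Re s ≥ 19/20` (identity theorem: `frakU2R = U` on the connected half-plane `σ > 9/10`,
`acVal_eq_of_continuation`). The input the prover of `Step16_u041aR` consumes.
[cite: Zhang2022LandauSiegel, §16 Lemma 16.2 p.94] -/
theorem frakU2R_explicit_bound_of_lemma162Rp (h : Lemma162Rp c') :
    ∃ C : ℝ, ForAllLarge fun D _ χ => AssumptionA D χ → ∀ j ∈ ({1, 2} : Finset ℕ),
      DifferentiableOn ℂ (frakU2R c' χ j) {s : ℂ | 9 / 10 < s.re} ∧
        (∀ s : ℂ, 1 < s.re → frakU2R c' χ j s = frakU2SeriesR c' χ j s) ∧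
        ∀ s : ℂ, 19 / 20 ≤ s.re → ‖frakU2R c' χ j s‖ ≤ C * Real.exp (2 * ell D ^ (1 / 10 : ℝ)) := by
  obtain ⟨C, D₀, hC⟩ := h
  refine ⟨C, D₀, fun D _ χ hD hq hp hA j hj => ?_⟩
  obtain ⟨U, hU, hUeq, _, hexp, _⟩ := hC D χ hD hq hp hA j hj
  obtain ⟨hdiff, hser⟩ := acVal_spec (f := frakU2SeriesR c' χ j) ⟨U, hU, hUeq⟩
  refine ⟨hdiff, hser, fun s hs => ?_⟩
  have hs' : (9 / 10 : ℝ) < s.re := by linarith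
  have h1 : frakU2R c' χ j s = U s := acVal_eq_of_continuation hU hUeq hs'
  rw [h1]
  exact hexp s hs


/-! ## `Lemma162Rq` — `Lemma162Rp` with a NEAR-ONE polylog clause (appended 2026-08-27, zl-w16-typer g2)

WHY (numbers; zl-libC-p1 FINDING F-u041aR-1, HOME/STATUS 2026-08-27T00:54Z; zl-w09-plan g2 ADVISORY
00:58:47Z; referees zl-w16-ref-2 NO OBJECTION 00:59:02Z, zl-w16-ref-1 concur 00:55:09Z). Clause (iv) of
`Lemma162Rp` (`‖U s‖ ≤ C·exp(2𝓛^{1/10})` on `Re s ≥ 19/20`) pays for the left line of the u041aR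
contour shift but NOT for the residue at the triple pole `s = 0` of `integrand16_u040R`: writing
`G(s) = L(1+s,χ)·P(s)·E(1+s)·Tˢω₁(s)`, `P(s) = (sζ(1+s))²ζ(1+s−βⱼ)L(1+s−βⱼ,χ)²`, the residue `½G″(0)`
contains `L′(1,χ)·P(0)·E′(1)` with `P(0) = −βⱼL′(1,χ)²(1+O(α𝓛³))` under (A), a term of modulus
`≍ α|L′|³|E′(1)|` that nothing cancels; the target `C(1+|L′|)³𝓛⁻⁴` therefore needs `|E′(1)| ≤ C′𝓛⁵`
(`α = π𝓛⁻⁹`), while Cauchy from (iv) only gives `|E′(1)| ≤ 20C·e^{2𝓛^{1/10}}`, and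
`e^{2𝓛^{1/10}} ≤ K𝓛⁵` fails for every `K` once `2𝓛^{1/10} > 5 log 𝓛` — fatal under `ForAllLarge`.
What suffices (any polylog near `1`; this is the house shape of `Typed.Section15C.calU1R_near_one_of_local`
and `Typed.Section16A.calM2_near_one_le`): clause (v) `‖s − 1‖ ≤ 1/𝓛 → ‖U s‖ ≤ C·𝓛`, TRUE by the
Euler product (on that disc `|q^{−s}| ≤ e/q` for `q ∣ D`, so `∏_{q∣D}(1 + c·q^{−σ}) ≤ (D/φ(D))^{⌈ce⌉}`
= polylog; the `q ∤ D` part is `O(1)` as in (iv)); Cauchy then gives `|E′(1)| ≤ C𝓛²`, `|E″(1)| ≤ 2C𝓛³`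
and covers `E(1+βⱼ)` (`|βⱼ| ≤ 5α ≪ 1/𝓛`). `Lemma162Rq := Lemma162Rp-body ∧ (v)`; the lifts to
`Lemma162Rp` / `Lemma162R` are projections, and `frakU2R_near_one_bound_of_lemma162Rq` transfers
(iv), (v) and the value clause to the chosen continuation `frakU2R` (identity theorem on the connected
half-plane `σ > 9/10`; the disc `‖s−1‖ ≤ 1/𝓛` lies inside it once `𝓛 ≥ 20`). WP-internal reading
(R-20, sub-leaf under `Eq16_16R2(E)`); no skeleton binder touched. -/

/-- **Lemma 16.2 for the repaired object, explicit bound AND near-one polylog clause** (reading of the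
printed "bounded for `σ > 9/10`", §16 p. 94 tex L4646–L4653): `Lemma162Rp` together with
(v) `∀ s, ‖s − 1‖ ≤ 1/𝓛 → ‖U(s)‖ ≤ C·𝓛` (same absolute `C`). NOT PRINTED (print leaves the
`D`-dependence of "bounded" unstated; both (iv) and (v) are implied by the uniform reading and weaker
than it). Implies `Lemma162Rp` (`lemma162Rp_of_Rq`) and `Lemma162R` (`lemma162R_of_Rq`). CLAIM — the
input the prover of `Step16_u041aR` consumes (zl-libC-p1 F-u041aR-1).
[cite: Zhang2022LandauSiegel, §16 Lemma 16.2 p.94] -/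
def Lemma162Rq : Prop :=
  ∃ C : ℝ, ForAllLarge fun D _ χ => AssumptionA D χ → ∀ j ∈ ({1, 2} : Finset ℕ),
    ∃ U : ℂ → ℂ, DifferentiableOn ℂ U {s : ℂ | 9 / 10 < s.re} ∧
      (∀ s : ℂ, 1 < s.re → U s = frakU2SeriesR c' χ j s) ∧
      (∃ B : ℝ, ∀ s : ℂ, 9 / 10 < s.re → ‖U s‖ ≤ B) ∧
      (∀ s : ℂ, 19 / 20 ≤ s.re → ‖U s‖ ≤ C * Real.exp (2 * ell D ^ (1 / 10 : ℝ))) ∧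
      (∀ s : ℂ, ‖s - 1‖ ≤ 1 / ell D → ‖U s‖ ≤ C * ell D) ∧
      ‖U 1 - frakU2Main χ‖ ≤ C * (ell D ^ 4)⁻¹

/-- `Lemma162Rq ⇒ Lemma162Rp` (drop the near-one clause). [cite: Zhang2022LandauSiegel, §16 Lemma 16.2 p.94] -/
theorem lemma162Rp_of_Rq (h : Lemma162Rq c') : Lemma162Rp c' := by
  obtain ⟨C, D₀, hC⟩ := h
  refine ⟨C, D₀, fun D _ χ hD hq hp hA j hj => ?_⟩
  obtain ⟨U, hU, hUeq, hB, hexp, -, hval⟩ := hC D χ hD hq hp hA j hj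
  exact ⟨U, hU, hUeq, hB, hexp, hval⟩

/-- `Lemma162Rq ⇒ Lemma162R`. [cite: Zhang2022LandauSiegel, §16 Lemma 16.2 p.94] -/
theorem lemma162R_of_Rq (h : Lemma162Rq c') : Lemma162R c' :=
  lemma162R_of_Rp c' (lemma162Rp_of_Rq c' h)

/-- `Lemma162Rq ⇒ Step16_u039R`. [cite: Zhang2022LandauSiegel, §16 Lemma 16.2 p.94] -/
theorem step16_u039R_of_lemma162Rq (h : Lemma162Rq c') : Step16_u039R c' :=
  step16_u039R_of_lemma162Rp c' (lemma162Rp_of_Rq c' h)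

/-- `Lemma162Rq ⇒ Step16_u041bR`. [cite: Zhang2022LandauSiegel, §16 p.94] -/
theorem step16_u041bR_of_lemma162Rq (h : Lemma162Rq c') : Step16_u041bR c' :=
  step16_u041bR_of_lemma162Rp c' (lemma162Rp_of_Rq c' h)

/-- `20 ≤ 𝓛 = log D` once `D ≥ 3²⁰` (`e < 3`). [folklore] -/
private theorem twenty_le_ell_of_le {D : ℕ} (hD : 3 ^ 20 ≤ D) : (20 : ℝ) ≤ ell D := by
  have hD' : ((3 : ℕ) ^ 20 : ℕ) ≤ (D : ℝ) := by exact_mod_cast hD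
  have h3 : ((3 : ℕ) ^ 20 : ℕ) = ((3 : ℝ) ^ (20 : ℕ)) := by push_cast; ring
  have hDpos : (0 : ℝ) < D := lt_of_lt_of_le (by rw [h3]; positivity) hD'
  have hlog3 : (1 : ℝ) ≤ Real.log 3 := by
    rw [← Real.log_exp 1]
    exact Real.log_le_log (Real.exp_pos 1) (by linarith [Real.exp_one_lt_d9])
  have hmono : Real.log ((3 : ℝ) ^ (20 : ℕ)) ≤ Real.log D :=
    Real.log_le_log (by positivity) (by rw [← h3]; exact hD')
  rw [Real.log_pow] at hmono
  rw [ell]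
  push_cast at hmono
  linarith

/-- On the disc `‖s − 1‖ ≤ 1/𝓛` with `𝓛 ≥ 20` one has `9/10 < Re s`. [folklore] -/
private theorem re_gt_of_near_one {D : ℕ} (hL : (20 : ℝ) ≤ ell D) {s : ℂ} (hs : ‖s - 1‖ ≤ 1 / ell D) :
    (9 / 10 : ℝ) < s.re := by
  have hLpos : (0 : ℝ) < ell D := by linarith
  have h1 : 1 / ell D ≤ (1 / 20 : ℝ) := by
    rw [div_le_div_iff₀ hLpos (by norm_num : (0 : ℝ) < 20)]
    linarith
  have h2 : |(s - 1).re| ≤ ‖s - 1‖ := Complex.abs_re_le_norm _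
  have h3 : (s - 1).re = s.re - 1 := by simp
  rw [h3] at h2
  have h4 : |s.re - 1| ≤ 1 / 20 := h2.trans (hs.trans h1)
  have h5 := (abs_le.mp h4).1
  linarith

/-- **The chosen continuation obeys BOTH explicit bounds and the value clause**: under `Lemma162Rq`,
for all large `D`, (A), `j = 1, 2`: `frakU2R c′ χ j` is differentiable on `σ > 9/10`, equals
`frakU2SeriesR` on `σ > 1`, satisfies `‖frakU2R s‖ ≤ C·exp(2𝓛^{1/10})` for `Re s ≥ 19/20`,
`‖frakU2R s‖ ≤ C·𝓛` for `‖s − 1‖ ≤ 1/𝓛`, and `‖frakU2R 1 − frakU2Main χ‖ ≤ C·𝓛⁻⁴` (identity theorem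
`acVal_eq_of_continuation` on the connected half-plane `σ > 9/10`, which contains the disc once
`𝓛 ≥ 20`, i.e. `D ≥ 3²⁰`). The by-name input of the `Step16_u041aR` prover (F-u041aR-1).
[cite: Zhang2022LandauSiegel, §16 Lemma 16.2 p.94] -/
theorem frakU2R_near_one_bound_of_lemma162Rq (h : Lemma162Rq c') :
    ∃ C : ℝ, ForAllLarge fun D _ χ => AssumptionA D χ → ∀ j ∈ ({1, 2} : Finset ℕ),
      DifferentiableOn ℂ (frakU2R c' χ j) {s : ℂ | 9 / 10 < s.re} ∧
        (∀ s : ℂ, 1 < s.re → frakU2R c' χ j s = frakU2SeriesR c' χ j s) ∧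
        (∀ s : ℂ, 19 / 20 ≤ s.re → ‖frakU2R c' χ j s‖ ≤ C * Real.exp (2 * ell D ^ (1 / 10 : ℝ))) ∧
        (∀ s : ℂ, ‖s - 1‖ ≤ 1 / ell D → ‖frakU2R c' χ j s‖ ≤ C * ell D) ∧
        ‖frakU2R c' χ j 1 - frakU2Main χ‖ ≤ C * (ell D ^ 4)⁻¹ := by
  obtain ⟨C, D₀, hC⟩ := h
  refine ⟨C, max D₀ (3 ^ 20), fun D _ χ hD hq hp hA j hj => ?_⟩
  have hD₀ : D₀ ≤ D := le_trans (le_max_left _ _) hD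
  have hL : (20 : ℝ) ≤ ell D := twenty_le_ell_of_le (le_trans (le_max_right _ _) hD)
  obtain ⟨U, hU, hUeq, _, hexp, hnear, hval⟩ := hC D χ hD₀ hq hp hA j hj
  obtain ⟨hdiff, hser⟩ := acVal_spec (f := frakU2SeriesR c' χ j) ⟨U, hU, hUeq⟩
  have hagree : ∀ s : ℂ, (9 / 10 : ℝ) < s.re → frakU2R c' χ j s = U s :=
    fun s hs => acVal_eq_of_continuation hU hUeq hs
  refine ⟨hdiff, hser, fun s hs => ?_, fun s hs => ?_, ?_⟩
  · rw [hagree s (by linarith)]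
    exact hexp s hs
  · rw [hagree s (re_gt_of_near_one hL hs)]
    exact hnear s hs
  · rw [hagree 1 (by norm_num)]
    exact hval

/-- The near-one clause in the reciprocal spelling `(ell D)⁻¹` (zl-libC-p1's hypothesis text of
2026-08-27T00:54Z), for consumers that wrote it that way. [cite: Zhang2022LandauSiegel, §16 Lemma 16.2 p.94] -/
theorem frakU2R_near_one_bound_of_lemma162Rq_inv (h : Lemma162Rq c') :
    ∃ C : ℝ, ForAllLarge fun D _ χ => AssumptionA D χ → ∀ j ∈ ({1, 2} : Finset ℕ),
      DifferentiableOn ℂ (frakU2R c' χ j) {s : ℂ | 9 / 10 < s.re} ∧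
        (∀ s : ℂ, 1 < s.re → frakU2R c' χ j s = frakU2SeriesR c' χ j s) ∧
        (∀ s : ℂ, 19 / 20 ≤ s.re → ‖frakU2R c' χ j s‖ ≤ C * Real.exp (2 * ell D ^ (1 / 10 : ℝ))) ∧
        (∀ s : ℂ, ‖s - 1‖ ≤ (ell D)⁻¹ → ‖frakU2R c' χ j s‖ ≤ C * ell D) ∧
        ‖frakU2R c' χ j 1 - frakU2Main χ‖ ≤ C * (ell D ^ 4)⁻¹ := by
  obtain ⟨C, hC⟩ := frakU2R_near_one_bound_of_lemma162Rq c' h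
  refine ⟨C, hC.mono fun D _ χ _ _ hS hA j hj => ?_⟩
  obtain ⟨h1, h2, h3, h4, h5⟩ := hS hA j hj
  exact ⟨h1, h2, h3, fun s hs => h4 s (by rwa [one_div]), h5⟩


/-! ## The converse packaging: `Lemma162Rp` + the near-one clause ON `frakU2R` ⇒ `Lemma162Rq`
(appended 2026-08-27, zl-w16-typer g2; RULING W16-S5a (2) / W16-S5b: Block D may deliver either the
pair (`lemma162Rp_holds`, `frakU2R_near_one_le`) or the one node `lemma162Rq_holds` — this bridge makes
the two deliverables interchangeable) -/

/-- **`Lemma162Rp` together with the near-one clause stated on the chosen continuation `frakU2R`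
(Sketch5 S12 text: `∃ C, ForAllLarge, (A) → ∀ j ∈ {1,2}, ∀ s, ‖s − 1‖ ≤ (ell D)⁻¹ →
‖frakU2R c′ χ j s‖ ≤ C·ell D`) gives `Lemma162Rq`**, with witness `U := frakU2R c′ χ j`: it is
differentiable on `σ > 9/10` and equals the series on `σ > 1` (`acVal_spec`), agrees there with the
`Lemma162Rp` witness (identity theorem `acVal_eq_of_continuation`), so it inherits boundedness, the
explicit bound (iv) and the value clause, while (v) is the hypothesis (constants merged by `max`).
[cite: Zhang2022LandauSiegel, §16 Lemma 16.2 p.94] -/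
theorem lemma162Rq_of_Rp_of_near_one (hRp : Lemma162Rp c')
    (hv : ∃ C : ℝ, ForAllLarge fun D _ χ => AssumptionA D χ → ∀ j ∈ ({1, 2} : Finset ℕ),
      ∀ s : ℂ, ‖s - 1‖ ≤ (ell D)⁻¹ → ‖frakU2R c' χ j s‖ ≤ C * ell D) :
    Lemma162Rq c' := by
  obtain ⟨C₁, D₁, h₁⟩ := hRp
  obtain ⟨C₂, D₂, h₂⟩ := hv
  refine ⟨max C₁ C₂, max D₁ D₂, fun D _ χ hD hq hp hA j hj => ?_⟩
  have hD₁ : D₁ ≤ D := le_trans (le_max_left _ _) hD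
  have hD₂ : D₂ ≤ D := le_trans (le_max_right _ _) hD
  obtain ⟨U, hU, hUeq, ⟨B, hB⟩, hexp, hval⟩ := h₁ D χ hD₁ hq hp hA j hj
  have hnear := h₂ D χ hD₂ hq hp hA j hj
  obtain ⟨hdiff, hser⟩ := acVal_spec (f := frakU2SeriesR c' χ j) ⟨U, hU, hUeq⟩
  have hagree : ∀ s : ℂ, (9 / 10 : ℝ) < s.re → frakU2R c' χ j s = U s :=
    fun s hs => acVal_eq_of_continuation hU hUeq hs
  have hℓ0 : 0 ≤ ell D := Real.log_natCast_nonneg D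
  refine ⟨frakU2R c' χ j, hdiff, hser, ⟨B, fun s hs => ?_⟩, fun s hs => ?_, fun s hs => ?_, ?_⟩
  · rw [hagree s hs]; exact hB s hs
  · rw [hagree s (by linarith)]
    calc ‖U s‖ ≤ C₁ * Real.exp (2 * ell D ^ (1 / 10 : ℝ)) := hexp s hs
      _ ≤ max C₁ C₂ * Real.exp (2 * ell D ^ (1 / 10 : ℝ)) :=
          mul_le_mul_of_nonneg_right (le_max_left _ _) (Real.exp_pos _).le
  · calc ‖frakU2R c' χ j s‖ ≤ C₂ * ell D := hnear s (by rwa [← one_div])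
      _ ≤ max C₁ C₂ * ell D := mul_le_mul_of_nonneg_right (le_max_right _ _) hℓ0
  · rw [hagree 1 (by norm_num)]
    calc ‖U 1 - frakU2Main χ‖ ≤ C₁ * (ell D ^ 4)⁻¹ := hval
      _ ≤ max C₁ C₂ * (ell D ^ 4)⁻¹ :=
          mul_le_mul_of_nonneg_right (le_max_left _ _) (inv_nonneg.mpr (pow_nonneg hℓ0 4))

/-- The same bridge with the near-one clause in the house spelling `1 / ell D`.
[cite: Zhang2022LandauSiegel, §16 Lemma 16.2 p.94] -/
theorem lemma162Rq_of_Rp_of_near_one' (hRp : Lemma162Rp c')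
    (hv : ∃ C : ℝ, ForAllLarge fun D _ χ => AssumptionA D χ → ∀ j ∈ ({1, 2} : Finset ℕ),
      ∀ s : ℂ, ‖s - 1‖ ≤ 1 / ell D → ‖frakU2R c' χ j s‖ ≤ C * ell D) :
    Lemma162Rq c' := by
  refine lemma162Rq_of_Rp_of_near_one c' hRp ?_
  obtain ⟨C, hC⟩ := hv
  refine ⟨C, hC.mono fun D _ χ _ _ hS hA j hj s hs => hS hA j hj s (by rwa [one_div])⟩

end Literature.NumberTheory.LFunctions.Zhang2022.Typed.Section16B
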